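import Summits.Ventures.CertifiedManyBodySolver.Observables.SourcedGibbsTrialCapAFRiemannCoeff
import HarnessLib

/-!
# The AF–BCS sourced cap in momentum space (XV-e): the energy integrand as an entry of `H f_β(H)` and its
# Lipschitz constant in the band variables `(ε, G)`

Cell hubbard-obs (seat hubbard-obs-pin-2). HONEST FRAMING: zero compute; real-analysis lemmas towards the uniform-in-`L`
packaging of the certified AF–BCS cap (`AF-TL-PACKAGING.md`, step 3): the energy integrand of
`groundEnergy_dWaveSourceTorus_le_AFBCS_kSpace` is `u↑ + u↓ = 2(ξc₀₀ + Gc₁₀ + Mc_{Q0}) − ξ` (`d₁₁ = 1 − c₀₀`,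
`d₀₁ = c₁₀`, `d_{Q1} = c_{Q0}`), and `ξc₀₀ + Gc₁₀ + Mc_{Q0} = (H f_β(H))₀₀ = (g_β(H))₀₀` with `g_β(x) = x f_β(x)`
(`5/4`-Lipschitz uniformly in `β`, file XV-a); hence `|w(ε,G) − w(ε',G')| ≤ (5/4)·2(|ε−ε'| + |G−G'|)` for
`w = ξc₀₀ + Gc₁₀ + Mc_{Q0}` (`μ' ≠ 0`, `M ≠ 0`) by the Hilbert–Schmidt Lipschitz bound. No number is claimed; not a
statement about order; not a superconductivity verdict.

* `continuous_fermiFn` — continuity of `f_β`; `cfc_mul_fermi_eq_mul_cfc` — `g_β(A) = A·f_β(A)` for Hermitian `A`;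
* `afBlock_mul_cfc_fermi_apply_zero_zero` — `(H f_β(H))₀₀ = ξc₀₀ + Gc₁₀ + Mc_{Q0}` in closed form;
* `abs_afEnergyCoeff_sub_le` — the Lipschitz bound in `(ε, G)`.

References: Davis–Rabinowitz (1984) §2.1 [DavisRabinowitz1984]; Hirsch PRB 31 (1985) 4403 [HirschPRB1985];
Rosenblum–Rovnyak (1985) Ch. 2 Addenda no. 3 Lemma A [RosenblumRovnyak1985].
-/

noncomputable section

open Real Finset Matrix

namespace Summit.Ventures.CertifiedManyBodySolver.Observables

/-! ### §1 `g_β(A) = A f_β(A)` -/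

/-- The Fermi function `x ↦ (1 − tanh(βx/2))/2` is continuous. [folklore] -/
theorem continuous_fermiFn (β : ℝ) : Continuous (fun x : ℝ => (1 - Real.tanh (β * x / 2)) / 2) := by
  have hc : Continuous Real.tanh := by
    rw [show Real.tanh = fun x => Real.sinh x / Real.cosh x from funext Real.tanh_eq_sinh_div_cosh]
    exact Real.continuous_sinh.div Real.continuous_cosh (fun x => (Real.cosh_pos x).ne')
  exact ((continuous_const.sub (hc.comp ((continuous_const.mul continuous_id).div_const _))).div_const _)

/-- For a Hermitian matrix `A`: `cfc (x ↦ x f_β(x)) A = A · cfc f_β A`. [folklore] -/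
theorem cfc_mul_fermi_eq_mul_cfc {ι : Type*} [Fintype ι] [DecidableEq ι] {A : Matrix ι ι ℂ}
    (hA : A.IsHermitian) (β : ℝ) :
    cfc (fun x : ℝ => x * ((1 - Real.tanh (β * x / 2)) / 2)) A =
      A * cfc (fun x : ℝ => (1 - Real.tanh (β * x / 2)) / 2) A := by
  have hsa : IsSelfAdjoint A := hA
  rw [cfc_mul (fun x : ℝ => x) (fun x : ℝ => (1 - Real.tanh (β * x / 2)) / 2) A continuousOn_id
    (continuous_fermiFn β).continuousOn, cfc_id' ℝ A hsa]

/-! ### §2 The energy coefficient as an entry of `H f_β(H)` -/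

/-- `(H f_β(H))₀₀ = ξc₀₀ + Gc₁₀ + Mc_{Q0}` in closed form for the AF block (`μ' ≠ 0`, `M ≠ 0`). [cite: HirschPRB1985] -/
theorem afBlock_mul_cfc_fermi_apply_zero_zero (ε G M μ' β : ℝ) (hμ : μ' ≠ 0) (hM : M ≠ 0) :
    (afBlock ε G M μ' * cfc (fun x : ℝ => (1 - Real.tanh (β * x / 2)) / 2) (afBlock ε G M μ')) 0 0 =
      ((((ε - μ') * (1 / 2 - Real.tanh (β * Real.sqrt ((Real.sqrt (ε ^ 2 + M ^ 2) + |μ'|) ^ 2 + G ^ 2) / 2) / (2 * Real.sqrt ((Real.sqrt (ε ^ 2 + M ^ 2) + |μ'|) ^ 2 + G ^ 2)) * ((ε - μ') / 2 - μ' / (2 * |μ'| * Real.sqrt (ε ^ 2 + M ^ 2)) * (ε ^ 2 + M ^ 2 - ε * μ')) - Real.tanh (β * Real.sqrt ((Real.sqrt (ε ^ 2 + M ^ 2) - |μ'|) ^ 2 + G ^ 2) / 2) / (2 * Real.sqrt ((Real.sqrt (ε ^ 2 + M ^ 2) - |μ'|) ^ 2 + G ^ 2)) * ((ε - μ') / 2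 + μ' / (2 * |μ'| * Real.sqrt (ε ^ 2 + M ^ 2)) * (ε ^ 2 + M ^ 2 - ε * μ'))) + G * (-G * (Real.tanh (β * Real.sqrt ((Real.sqrt (ε ^ 2 + M ^ 2) + |μ'|) ^ 2 + G ^ 2) / 2) / (2 * Real.sqrt ((Real.sqrt (ε ^ 2 + M ^ 2) + |μ'|) ^ 2 + G ^ 2)) * (1 / 2 - μ' / (2 * |μ'| * Real.sqrt (ε ^ 2 + M ^ 2)) * ε) + Real.tanh (β * Real.sqrt ((Real.sqrt (ε ^ 2 + M ^ 2) - |μ'|) ^ 2 + G ^ 2) / 2) / (2 * Real.sqrt ((Real.sqrt (ε ^ 2 + M ^ 2) - |μ'|) ^ 2 + G ^ 2)) * (1 / 2 + μ' / (2 * |μ'| * Real.sqrt (ε ^ 2 + M ^ 2)) * ε))) + M * (-M * (Real.tanh (β * Real.sqrt ((Real.sqrt (ε ^ 2 + M ^ 2) + |μ'|) ^ 2 + G ^ 2) / 2) / (2 * Real.sqrt ((Real.sqrt (ε ^ 2 + M ^ 2) + |μ'|) ^ 2 + G ^ 2)) * (1 / 2 + μ' / (2 * |μ'| * Real.sqrt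 (ε ^ 2 + M ^ 2)) * μ') + Real.tanh (β * Real.sqrt ((Real.sqrt (ε ^ 2 + M ^ 2) - |μ'|) ^ 2 + G ^ 2) / 2) / (2 * Real.sqrt ((Real.sqrt (ε ^ 2 + M ^ 2) - |μ'|) ^ 2 + G ^ 2)) * (1 / 2 - μ' / (2 * |μ'| * Real.sqrt (ε ^ 2 + M ^ 2)) * μ')))) : ℝ) : ℂ) := by
  have hcol := cfc_fermi_afBlock_mulVec_single_zero_eq ε G M μ' β hμ hM
  rw [Matrix.mulVec_single_one] at hcol
  have h0 := congrFun hcol 0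
  have h1 := congrFun hcol 1
  have h2 := congrFun hcol 2
  have h3 := congrFun hcol 3
  simp only [Matrix.col_apply, Matrix.cons_val_zero, Matrix.cons_val_one, Matrix.head_cons, Matrix.cons_val_two,
    Matrix.tail_cons, Matrix.cons_val_three] at h0 h1 h2 h3
  rw [Matrix.mul_apply, Fin.sum_univ_four, h0, h1, h2, h3]
  simp [afBlock]

/-! ### §3 Lipschitz bound in `(ε, G)` -/

/-- **The AF energy coefficient `w = ξc₀₀ + Gc₁₀ + Mc_{Q0}` is `5/2`-Lipschitz in `(ε, G)`**, uniformly in `β`: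
`|w(ε, G) − w(ε', G')| ≤ (5/4)·2(|ε − ε'| + |G − G'|)` (`μ' ≠ 0`, `M ≠ 0`) — Hilbert–Schmidt Lipschitz bound for
`g_β(x) = x f_β(x)` (constant `5/4`) on the two AF blocks.
[cite: DavisRabinowitz1984, §2.1 eq. (2.1.6)] [cite: RosenblumRovnyak1985, Ch. 2 Examples and Addenda no. 3 Lemma A] -/
theorem abs_afEnergyCoeff_sub_le (β : ℝ) {μ' M : ℝ} (hμ : μ' ≠ 0) (hM : M ≠ 0) (ε G ε' G' : ℝ) :
    |((ε - μ') * (1 / 2 - Real.tanh (β * Real.sqrt ((Real.sqrt (ε ^ 2 + M ^ 2) + |μ'|) ^ 2 + G ^ 2) / 2) / (2 * Real.sqrt ((Real.sqrt (ε ^ 2 + M ^ 2) + |μ'|) ^ 2 + G ^ 2)) * ((ε - μ') / 2 - μ' / (2 * |μ'| * Real.sqrt (ε ^ 2 + M ^ 2)) * (ε ^ 2 + M ^ 2 - ε * μ')) - Real.tanh (β * Real.sqrt ((Real.sqrt (ε ^ 2 + M ^ 2) - |μ'|) ^ 2 + G ^ 2) / 2) / (2 * Real.sqrt ((Real.sqrt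 (ε ^ 2 + M ^ 2) - |μ'|) ^ 2 + G ^ 2)) * ((ε - μ') / 2 + μ' / (2 * |μ'| * Real.sqrt (ε ^ 2 + M ^ 2)) * (ε ^ 2 + M ^ 2 - ε * μ'))) + G * (-G * (Real.tanh (β * Real.sqrt ((Real.sqrt (ε ^ 2 + M ^ 2) + |μ'|) ^ 2 + G ^ 2) / 2) / (2 * Real.sqrt ((Real.sqrt (ε ^ 2 + M ^ 2) + |μ'|) ^ 2 + G ^ 2)) * (1 / 2 - μ' / (2 * |μ'| * Real.sqrt (ε ^ 2 + M ^ 2)) * ε) + Real.tanh (β * Real.sqrt ((Real.sqrt (ε ^ 2 + M ^ 2) - |μ'|) ^ 2 + G ^ 2) / 2) / (2 * Real.sqrt ((Real.sqrt (ε ^ 2 + M ^ 2) - |μ'|) ^ 2 + G ^ 2)) * (1 / 2 + μ' / (2 * |μ'| * Real.sqrt (ε ^ 2 + M ^ 2)) * ε))) + M * (-M * (Real.tanh (β * Real.sqrt ((Real.sqrt (ε ^ 2 + M ^ 2) + |μ'|) ^ 2 + G ^ 2) / 2) / (2 * Real.sqrt ((Real.sqrt (ε ^ 2 + M ^ 2)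 + |μ'|) ^ 2 + G ^ 2)) * (1 / 2 + μ' / (2 * |μ'| * Real.sqrt (ε ^ 2 + M ^ 2)) * μ') + Real.tanh (β * Real.sqrt ((Real.sqrt (ε ^ 2 + M ^ 2) - |μ'|) ^ 2 + G ^ 2) / 2) / (2 * Real.sqrt ((Real.sqrt (ε ^ 2 + M ^ 2) - |μ'|) ^ 2 + G ^ 2)) * (1 / 2 - μ' / (2 * |μ'| * Real.sqrt (ε ^ 2 + M ^ 2)) * μ')))) - ((ε' - μ') * (1 / 2 - Real.tanh (β * Real.sqrt ((Real.sqrt (ε' ^ 2 + M ^ 2) + |μ'|) ^ 2 + G' ^ 2) / 2) / (2 * Real.sqrt ((Real.sqrt (ε' ^ 2 + M ^ 2) + |μ'|) ^ 2 + G' ^ 2)) * ((ε' - μ') / 2 - μ' / (2 * |μ'| * Real.sqrt (ε' ^ 2 + M ^ 2)) * (ε' ^ 2 + M ^ 2 - ε' * μ')) - Real.tanh (β * Real.sqrt ((Real.sqrt (ε' ^ 2 + M ^ 2) - |μ'|) ^ 2 + G' ^ 2) / 2) / (2 * Real.sqrt ((Real.sqrt (ε' ^ 2 + M ^ 2) -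 |μ'|) ^ 2 + G' ^ 2)) * ((ε' - μ') / 2 + μ' / (2 * |μ'| * Real.sqrt (ε' ^ 2 + M ^ 2)) * (ε' ^ 2 + M ^ 2 - ε' * μ'))) + G' * (-G' * (Real.tanh (β * Real.sqrt ((Real.sqrt (ε' ^ 2 + M ^ 2) + |μ'|) ^ 2 + G' ^ 2) / 2) / (2 * Real.sqrt ((Real.sqrt (ε' ^ 2 + M ^ 2) + |μ'|) ^ 2 + G' ^ 2)) * (1 / 2 - μ' / (2 * |μ'| * Real.sqrt (ε' ^ 2 + M ^ 2)) * ε') + Real.tanh (β * Real.sqrt ((Real.sqrt (ε' ^ 2 + M ^ 2) - |μ'|) ^ 2 + G' ^ 2) / 2) / (2 * Real.sqrt ((Real.sqrt (ε' ^ 2 + M ^ 2) - |μ'|) ^ 2 + G' ^ 2)) * (1 / 2 + μ' / (2 * |μ'| * Real.sqrt (ε' ^ 2 + M ^ 2)) * ε'))) + M * (-M * (Real.tanh (β * Real.sqrt ((Real.sqrt (ε' ^ 2 + M ^ 2) + |μ'|) ^ 2 + G' ^ 2) / 2) / (2 * Real.sqrt ((Real.sqrt (ε' ^ 2 + M ^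 2) + |μ'|) ^ 2 + G' ^ 2)) * (1 / 2 + μ' / (2 * |μ'| * Real.sqrt (ε' ^ 2 + M ^ 2)) * μ') + Real.tanh (β * Real.sqrt ((Real.sqrt (ε' ^ 2 + M ^ 2) - |μ'|) ^ 2 + G' ^ 2) / 2) / (2 * Real.sqrt ((Real.sqrt (ε' ^ 2 + M ^ 2) - |μ'|) ^ 2 + G' ^ 2)) * (1 / 2 - μ' / (2 * |μ'| * Real.sqrt (ε' ^ 2 + M ^ 2)) * μ'))))| ≤ 5 / 4 * (2 * (|ε - ε'| + |G - G'|)) := by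
  have h := norm_mul_fermi_cfc_sub_apply_le β (afBlock_isHermitian ε G M μ') (afBlock_isHermitian ε' G' M μ') 0 0
  rw [cfc_mul_fermi_eq_mul_cfc (afBlock_isHermitian ε G M μ'), cfc_mul_fermi_eq_mul_cfc (afBlock_isHermitian ε' G' M μ'),
    Matrix.sub_apply, afBlock_mul_cfc_fermi_apply_zero_zero ε G M μ' β hμ hM,
    afBlock_mul_cfc_fermi_apply_zero_zero ε' G' M μ' β hμ hM, ← Complex.ofReal_sub, Complex.norm_real,
    Real.norm_eq_abs] at h
  exact h.trans (mul_le_mul_of_nonneg_left (sqrt_sum_norm_sq_afBlock_sub_le ε G ε' G' M μ') (by norm_num))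

end Summit.Ventures.CertifiedManyBodySolver.Observables
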